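import Summits.QuantumFields.YangMills.Theorems.SwapVirialDeficitLocalTwoSidedStiffness
import Summits.QuantumFields.YangMills.Theorems.SwapVirialDeficitBlowUpVirialRing
import Summits.QuantumFields.YangMills.Theorems.SwapVirialDeficitSectorLaplacePlaneParts
import Summits.QuantumFields.YangMills.Theorems.SwapVirialDeficitBlowUpGnomonicFibreHessianPackage
import HarnessLib

/-!
# The CHART-SIDE MEASURE of a seam sector and the transfer `(TS)_z ⟸ stiffness on the chart side`
# (LEAD ym-line-sfw-p2 g98, free hands; cell ym-idea-1; `--supports stmt-QuantumFields-24197`; memo5 ➎ «localize the two-sided law»)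

The regions of skeleton ➎ live in the joint gnomonic chart, i.e. in `ℍ × GnoSign L × GnoCoord L` (hub, hemisphere signs, gnomonic letters).  To apply the
generic assembly ✓`SwapRing.stiffness_of_regions` ∕ ✓`stiffness_of_regions_and_core` ∕ ✓`stiffness_of_local_twoSided_laws` there one needs ONE measure on that
space whose integrals are the iterated chart integrals `K_L·∫_cone Σ_ε ∫ (·)·ρ dη` of ✓`integral_exp_swapDeficit_eq_gnomonic` ∕ ✓`integral_swapDeficit_exp_eq_gnomonic`.
This file supplies it WITHOUT a new definition (the measure is written out; a later `def chartMeasure` in the Defs file can be matched by `rfl`):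

* §1 `measurable_gnoDeficit_triple` (`(a, ε, η) ↦ F̂_{a,ε}(η)` measurable), `gnoDeficit_triple_bound`; the finite product measure (✓`isFiniteMeasure_volume_gnoDensity`)
  `(coneMeasure ⊗ count) ⊗ ρ·vol` and ★ `integral_coneSignDensity_prod` — its integral of a bounded measurable `f` is `∫_cone Σ_ε ∫ f(a,ε,η)·ρ(η) dη da`;
* §2 ★★ `sector_laplace_eq_chartMeasure` ∕ `sector_meanDeficit_eq_chartMeasure` — `∫ e^{−bF_z} dμ_L` and `∫ F_z e^{−bF_z} dμ_L` as integrals against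
  `K_L • ((coneMeasure ⊗ count) ⊗ ρ·vol)` of `e^{−bF̂}` and `F̂ e^{−bF̂}`;
* §3 ★★★ `sector_stiffness_of_chart_stiffness` — `κ·∫e^{−bF̂}dμ_chart ≤ b·∫F̂ e^{−bF̂}dμ_chart ⟹ κ·Ẑ_z(b) ≤ b·Ê_z(b)`, the per-sector hypothesis `(TS)_z`
  of ✓`swapGluedStiffness_of_twoSectorStiffness`; ★★★ `sector_stiffness_of_regions_and_core` — the same directly from REGION data on the chart side
  (✓`stiffness_of_regions_and_core` instantiated: `F̂ ≥ 0` bounded measurable, the chart measure finite).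

HONEST LABEL: measure-theoretic plumbing (a reduction); the regions' laws are OPEN; ⟨24197⟩ ∕ ⟨24194⟩ OPEN; ⟨24196⟩ proved elsewhere; own crux ⟨22884⟩ OPEN
(blocked-on ⟨19935⟩); no rung of record or summit is proved; the Yang–Mills mass gap is NOT proved; no summit is proved by a line.  THEOREMS ONLY (0 `def`,
0 `sorry`), standard axioms; the series' local `ℍ` measurable-space instances.  References: [cite: tHooft1979]; [cite: Luscher1983, §2]; [folklore].
-/

set_option autoImplicit false
set_option synthInstance.maxSize 1024

noncomputable section

open MeasureTheory Quaternion Set Filter Function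
open scoped Quaternion BigOperators ENNReal
open Literature.MathematicalPhysics.QuantumLattice
open Literature.MathematicalPhysics.QuantumFieldTheory hiding SU2
open Summit.QuantumFields.YangMills.Theorems.FemtoTransferGap
open Summit.QuantumFields.YangMills.Theorems.FemtoTransferGap.TT
open Summit.QuantumFields.YangMills.Theorems.VirialFluxGap.RingDeficit
open Summit.QuantumFields.YangMills.Theorems.SwapTwistDeficit.ToronLog (coneMeasure coneConst coneConst_pos isProbabilityMeasure_coneMeasure)
open Summit.QuantumFields.YangMills.Theorems.SwapVirialDeficit.SwapRing

attribute [local instance] Literature.Analysis.FluidPDE.Tao2016.quatMeasurableSpace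
  Literature.Analysis.FluidPDE.Tao2016.quatBorelSpace
  Literature.MathematicalPhysics.QuantumLattice.secondCountableTopology_su2

namespace Summit.QuantumFields.YangMills.Theorems.SwapVirialDeficit.BlowUpRing

open Summit.QuantumFields.YangMills.Theorems.SwapVirialDeficit.SectorLaplace (KL KL_nonneg)

variable {L : ℕ} [NeZero L]

/-! ## §1 The chart-side product measure and its iterated integral -/

omit [NeZero L] in
/-- The re-association `(a, ε, η) ↦ (ε, (a, η))` is measurable. [folklore] -/
theorem measurable_signFirst :
    Measurable fun q : ℍ × GnoSign L × GnoCoord L => (q.2.1, (q.1, q.2.2)) :=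
  (measurable_fst.comp measurable_snd).prodMk (measurable_fst.prodMk (measurable_snd.comp measurable_snd))

/-- The triple deficit factors through the re-association (a definitional bookkeeping step, stated to keep unification cheap). [folklore] -/
theorem gnoDeficit_triple_eq_comp (z : Fin 3 → Bool) (χ : Site 3 L → SU2) :
    (fun q : ℍ × GnoSign L × GnoCoord L => gnoDeficit z χ q.1 q.2.1 q.2.2) =
      (fun p : GnoSign L × (ℍ × GnoCoord L) => gnoDeficit z χ p.2.1 p.1 p.2.2) ∘ (fun q => (q.2.1, (q.1, q.2.2))) := by
  funext q; simp only [Function.comp_apply]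

/-- `(a, ε, η) ↦ F̂_{z,a,ε}(η)` is measurable on `ℍ × GnoSign L × GnoCoord L` (the sign factor is finite and discrete). [folklore] -/
theorem measurable_gnoDeficit_triple (z : Fin 3 → Bool) (χ : Site 3 L → SU2) :
    Measurable fun q : ℍ × GnoSign L × GnoCoord L => gnoDeficit z χ q.1 q.2.1 q.2.2 := by
  have h1 : Measurable fun p : GnoSign L × (ℍ × GnoCoord L) => gnoDeficit z χ p.2.1 p.1 p.2.2 :=
    measurable_from_prod_countable_right fun ε => measurable_gnoDeficit_uncurry z χ ε
  rw [gnoDeficit_triple_eq_comp]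
  exact h1.comp measurable_signFirst

/-- The chart deficit of the principal character is bounded: `|F̂| ≤ B` with the ring bound `B` of ✓`exists_abs_swapRingDeficit_le`. [folklore] -/
theorem gnoDeficit_triple_bound (z : Fin 3 → Bool) :
    ∃ B : ℝ, ∀ q : ℍ × GnoSign L × GnoCoord L, |gnoDeficit z (fun _ => 1) q.1 q.2.1 q.2.2| ≤ B := by
  obtain ⟨B, hB⟩ := exists_abs_swapRingDeficit_le (L := L) z
  exact ⟨B, fun q => hB _⟩

/-- The counting measure on the finite sign type is finite. [folklore] -/
theorem isFiniteMeasure_count_gnoSign : IsFiniteMeasure (Measure.count : Measure (GnoSign L)) := by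
  refine ⟨?_⟩
  rw [Measure.count_apply MeasurableSet.univ, Set.encard_univ, ENat.card_eq_coe_natCard]
  exact ENat.toENNReal_lt_top.2 (ENat.coe_lt_top _)

/-- If `|f| ≤ g` pointwise with `g` integrable then `|∫f| ≤ ∫g`. [folklore] -/
theorem abs_integral_le_of_forall_abs_le {α : Type*} [MeasurableSpace α] {μ : Measure α} {f g : α → ℝ} (hg : Integrable g μ)
    (h : ∀ x, |f x| ≤ g x) : |∫ x, f x ∂μ| ≤ ∫ x, g x ∂μ := by
  calc |∫ x, f x ∂μ| = ‖∫ x, f x ∂μ‖ := (Real.norm_eq_abs _).symm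
    _ ≤ ∫ x, ‖f x‖ ∂μ := norm_integral_le_integral_norm _
    _ ≤ ∫ x, g x ∂μ := integral_mono_of_nonneg (Eventually.of_forall fun x => norm_nonneg _) hg
        (Eventually.of_forall fun x => by simp only [Real.norm_eq_abs]; exact h x)

/-- ★ **THE ITERATED FORM OF THE CHART PRODUCT MEASURE**: for bounded measurable `f` on `ℍ × GnoSign L × GnoCoord L`,
`∫ f d(cone ⊗ (count ⊗ ρ·vol)) = ∫_cone Σ_ε ∫ f(a,ε,η)·ρ(η) dη da`. [folklore] -/
theorem integral_coneSignDensity_prod {f : ℍ × GnoSign L × GnoCoord L → ℝ} (hf : Measurable f) {M : ℝ} (hbd : ∀ q, |f q| ≤ M) :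
    ∫ q, f q ∂(coneMeasure.prod ((Measure.count : Measure (GnoSign L)).prod
        ((volume : Measure (GnoCoord L)).withDensity fun η => ENNReal.ofReal (gnoDensity η)))) =
      ∫ a, (∑ ε : GnoSign L, ∫ η : GnoCoord L, f (a, ε, η) * gnoDensity η) ∂coneMeasure := by
  haveI := isProbabilityMeasure_coneMeasure
  haveI := isFiniteMeasure_volume_gnoDensity (L := L)
  haveI := isFiniteMeasure_count_gnoSign (L := L)
  set ν : Measure (GnoCoord L) := (volume : Measure (GnoCoord L)).withDensity fun η => ENNReal.ofReal (gnoDensity η) with hν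
  -- Fubini over the hub
  have hfi : Integrable f (coneMeasure.prod ((Measure.count : Measure (GnoSign L)).prod ν)) :=
    Integrable.mono' (integrable_const M) hf.aestronglyMeasurable (Eventually.of_forall fun p => by rw [Real.norm_eq_abs]; exact hbd p)
  rw [integral_prod f hfi]
  refine integral_congr_ae (Eventually.of_forall fun a => ?_)
  -- Fubini over the signs, at fixed hub
  have hfa : Measurable fun q : GnoSign L × GnoCoord L => f (a, q) := hf.comp (measurable_const.prodMk measurable_id)
  have hfai : Integrable (fun q : GnoSign L × GnoCoord L => f (a, q)) ((Measure.count : Measure (GnoSign L)).prod ν) :=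
    Integrable.mono' (integrable_const M) hfa.aestronglyMeasurable (Eventually.of_forall fun p => by rw [Real.norm_eq_abs]; exact hbd _)
  change ∫ q, f (a, q) ∂((Measure.count : Measure (GnoSign L)).prod ν) = _
  rw [integral_prod _ hfai]
  -- the innermost integral against `ρ·vol`
  have hinner : ∀ ε : GnoSign L, ∫ η, f (a, (ε, η)) ∂ν = ∫ η, f (a, ε, η) * gnoDensity η := by
    intro ε
    have hdm : Measurable fun η : GnoCoord L => ENNReal.ofReal (gnoDensity η) := ENNReal.measurable_ofReal.comp measurable_gnoDensity
    rw [hν, integral_withDensity_eq_integral_toReal_smul hdm (Eventually.of_forall fun _ => ENNReal.ofReal_lt_top)]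
    exact integral_congr_ae (Eventually.of_forall fun η => by
      simp only [ENNReal.toReal_ofReal (gnoDensity_pos η).le, smul_eq_mul, mul_comm])
  have hkbd : ∀ ε : GnoSign L, |∫ η, f (a, ε, η) * gnoDensity η| ≤ M * ∫ η : GnoCoord L, gnoDensity η := by
    intro ε
    rw [← integral_const_mul]
    refine abs_integral_le_of_forall_abs_le (integrable_gnoDensity.const_mul M) fun η => ?_
    rw [abs_mul, abs_of_pos (gnoDensity_pos η)]
    exact mul_le_mul_of_nonneg_right (hbd _) (gnoDensity_pos η).le
  -- the counting integral over the finite sign type is the sum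
  have hsec : Integrable (fun ε : GnoSign L => ∫ η, f (a, (ε, η)) ∂ν) (Measure.count : Measure (GnoSign L)) :=
    Integrable.mono' (integrable_const (M * ∫ η : GnoCoord L, gnoDensity η))
      (measurable_of_countable _).aestronglyMeasurable (Eventually.of_forall fun ε => by rw [Real.norm_eq_abs, hinner]; exact hkbd ε)
  change ∫ ε, (fun ε : GnoSign L => ∫ η, f (a, (ε, η)) ∂ν) ε ∂Measure.count = _
  rw [integral_fintype hsec]
  refine Finset.sum_congr rfl fun ε _ => ?_
  rw [Measure.real, Measure.count_singleton, ENNReal.toReal_one, one_smul, hinner]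

/-! ## §2 The sector Laplace integral and mean deficit against the chart measure -/

/-- ★★ `∫ e^{−bF_z} dμ_L = ∫ e^{−bF̂} dμ_chart` with `μ_chart = K_L • (cone ⊗ (count ⊗ ρ·vol))` written out (`b ≥ 0`). [cite: tHooft1979] -/
theorem sector_laplace_eq_chartMeasure (z : Fin 3 → Bool) {b : ℝ} (hb : 0 ≤ b) (μc : Measure (ℍ × GnoSign L × GnoCoord L))
    (hμc : μc = ENNReal.ofReal (KL L) • coneMeasure.prod ((Measure.count : Measure (GnoSign L)).prod
      ((volume : Measure (GnoCoord L)).withDensity fun η => ENNReal.ofReal (gnoDensity η)))) :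
    ∫ p, Real.exp (-(b * swapRingDeficit L z p)) ∂(ringMeasure L) =
      ∫ q, Real.exp (-b * gnoDeficit z (fun _ => 1) q.1 q.2.1 q.2.2) ∂μc := by
  have hf : Measurable fun q : ℍ × GnoSign L × GnoCoord L => Real.exp (-b * gnoDeficit z (fun _ => 1) q.1 q.2.1 q.2.2) :=
    ((measurable_gnoDeficit_triple z _).const_mul (-b)).exp
  have hbd : ∀ q : ℍ × GnoSign L × GnoCoord L, |Real.exp (-b * gnoDeficit z (fun _ => 1) q.1 q.2.1 q.2.2)| ≤ 1 := fun q => by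
    rw [abs_of_pos (Real.exp_pos _)]
    exact Real.exp_le_one_iff.2 (by have := gnoDeficit_nonneg z (fun _ => (1 : SU2)) q.1 q.2.1 q.2.2; nlinarith)
  have h1 := integral_coneSignDensity_prod hf hbd
  have h2 := integral_exp_swapDeficit_eq_gnomonic (L := L) z hb
  rw [hμc, integral_smul_measure, ENNReal.toReal_ofReal KL_nonneg, smul_eq_mul, h1, h2]
  simp only [neg_mul]
  rfl

/-- ★★ `∫ F_z e^{−bF_z} dμ_L = ∫ F̂ e^{−bF̂} dμ_chart` (`b ≥ 0`). [cite: tHooft1979] -/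
theorem sector_meanDeficit_eq_chartMeasure (z : Fin 3 → Bool) {b : ℝ} (hb : 0 ≤ b) (μc : Measure (ℍ × GnoSign L × GnoCoord L))
    (hμc : μc = ENNReal.ofReal (KL L) • coneMeasure.prod ((Measure.count : Measure (GnoSign L)).prod
      ((volume : Measure (GnoCoord L)).withDensity fun η => ENNReal.ofReal (gnoDensity η)))) :
    ∫ p, swapRingDeficit L z p * Real.exp (-(b * swapRingDeficit L z p)) ∂(ringMeasure L) =
      ∫ q, gnoDeficit z (fun _ => 1) q.1 q.2.1 q.2.2 * Real.exp (-b * gnoDeficit z (fun _ => 1) q.1 q.2.1 q.2.2) ∂μc := by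
  obtain ⟨B, hB⟩ := exists_abs_swapRingDeficit_le (L := L) z
  have hf : Measurable fun q : ℍ × GnoSign L × GnoCoord L =>
      gnoDeficit z (fun _ => 1) q.1 q.2.1 q.2.2 * Real.exp (-b * gnoDeficit z (fun _ => 1) q.1 q.2.1 q.2.2) :=
    (measurable_gnoDeficit_triple z _).mul ((measurable_gnoDeficit_triple z _).const_mul (-b)).exp
  have hbd : ∀ q : ℍ × GnoSign L × GnoCoord L,
      |gnoDeficit z (fun _ => 1) q.1 q.2.1 q.2.2 * Real.exp (-b * gnoDeficit z (fun _ => 1) q.1 q.2.1 q.2.2)| ≤ B := fun q => by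
    have h0 := gnoDeficit_nonneg z (fun _ => (1 : SU2)) q.1 q.2.1 q.2.2
    rw [abs_mul, abs_of_pos (Real.exp_pos _), abs_of_nonneg h0]
    have h1 : Real.exp (-b * gnoDeficit z (fun _ => 1) q.1 q.2.1 q.2.2) ≤ 1 := Real.exp_le_one_iff.2 (by nlinarith)
    calc gnoDeficit z (fun _ => 1) q.1 q.2.1 q.2.2 * Real.exp (-b * gnoDeficit z (fun _ => 1) q.1 q.2.1 q.2.2)
        ≤ gnoDeficit z (fun _ => 1) q.1 q.2.1 q.2.2 * 1 := mul_le_mul_of_nonneg_left h1 h0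
      _ ≤ B := by rw [mul_one]; exact (le_abs_self _).trans (hB _)
  have h1 := integral_coneSignDensity_prod hf hbd
  have h2 := integral_swapDeficit_exp_eq_gnomonic (L := L) z hb
  rw [hμc, integral_smul_measure, ENNReal.toReal_ofReal KL_nonneg, smul_eq_mul, h1, h2]
  simp only [neg_mul]
  rfl

/-- The chart measure is finite (`K_L·1·|GnoSign L|·∫ρ < ∞`). [folklore] -/
theorem isFiniteMeasure_chartMeasure (μc : Measure (ℍ × GnoSign L × GnoCoord L))
    (hμc : μc = ENNReal.ofReal (KL L) • coneMeasure.prod ((Measure.count : Measure (GnoSign L)).prod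
      ((volume : Measure (GnoCoord L)).withDensity fun η => ENNReal.ofReal (gnoDensity η)))) :
    IsFiniteMeasure μc := by
  haveI := isProbabilityMeasure_coneMeasure
  haveI := isFiniteMeasure_volume_gnoDensity (L := L)
  haveI := isFiniteMeasure_count_gnoSign (L := L)
  rw [hμc]
  refine ⟨?_⟩
  rw [Measure.smul_apply, smul_eq_mul]
  exact ENNReal.mul_lt_top ENNReal.ofReal_lt_top (measure_lt_top _ _)

/-! ## §3 `(TS)_z` from stiffness on the chart side, and from region data -/

/-- ★★★ **`(TS)_z` FROM CHART-SIDE STIFFNESS**: `κ·∫e^{−bF̂}dμ_chart ≤ b·∫F̂ e^{−bF̂}dμ_chart ⟹ κ·Ẑ_z(b) ≤ b·Ê_z(b)` — the per-sector hypothesis of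
✓`swapGluedStiffness_of_twoSectorStiffness` (`b ≥ 0`). [cite: tHooft1979] -/
theorem sector_stiffness_of_chart_stiffness (z : Fin 3 → Bool) {b κ : ℝ} (hb : 0 ≤ b) (μc : Measure (ℍ × GnoSign L × GnoCoord L))
    (hμc : μc = ENNReal.ofReal (KL L) • coneMeasure.prod ((Measure.count : Measure (GnoSign L)).prod
      ((volume : Measure (GnoCoord L)).withDensity fun η => ENNReal.ofReal (gnoDensity η))))
    (h : κ * ∫ q, Real.exp (-b * gnoDeficit z (fun _ => 1) q.1 q.2.1 q.2.2) ∂μc ≤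
      b * ∫ q, gnoDeficit z (fun _ => 1) q.1 q.2.1 q.2.2 * Real.exp (-b * gnoDeficit z (fun _ => 1) q.1 q.2.1 q.2.2) ∂μc) :
    κ * ∫ p, Real.exp (-(b * swapRingDeficit L z p)) ∂(ringMeasure L) ≤
      b * ∫ p, swapRingDeficit L z p * Real.exp (-(b * swapRingDeficit L z p)) ∂(ringMeasure L) := by
  rw [sector_laplace_eq_chartMeasure z hb μc hμc, sector_meanDeficit_eq_chartMeasure z hb μc hμc]
  exact h

/-- ★★★ **`(TS)_z` FROM REGION-LOCAL DATA ON THE CHART SIDE** (✓`stiffness_of_regions_and_core` instantiated): `b > 0`; finitely many pairwise disjoint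
measurable regions `R_i ⊆ ℍ × GnoSign L × GnoCoord L`, each stiff with surplus `sur` for `F̂ = F̂_z` against the chart measure; a measurable core `N`
disjoint from them with `κ·∫_N e^{−bF̂} ≤ sur·Σ_i∫_{R_i}e^{−bF̂}`; and `κ ≤ b·F̂` off `N ∪ ⋃R_i` (e.g. the bad hemisphere signs, ✓`badSign_floor`).
Then `κ·Ẑ_z(b) ≤ b·Ê_z(b)`. [cite: tHooft1979] [folklore] -/
theorem sector_stiffness_of_regions_and_core (z : Fin 3 → Bool) {b κ sur : ℝ} (hb : 0 < b) (μc : Measure (ℍ × GnoSign L × GnoCoord L))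
    (hμc : μc = ENNReal.ofReal (KL L) • coneMeasure.prod ((Measure.count : Measure (GnoSign L)).prod
      ((volume : Measure (GnoCoord L)).withDensity fun η => ENNReal.ofReal (gnoDensity η))))
    {ι : Type*} (s : Finset ι) (R : ι → Set (ℍ × GnoSign L × GnoCoord L)) (hR : ∀ i ∈ s, MeasurableSet (R i))
    (hdisj : (s : Set ι).Pairwise (Disjoint on R)) {N : Set (ℍ × GnoSign L × GnoCoord L)} (hN : MeasurableSet N)
    (hNdisj : ∀ i ∈ s, Disjoint N (R i))
    (hloc : ∀ i ∈ s, (κ + sur) * ∫ q in R i, Real.exp (-b * gnoDeficit z (fun _ => 1) q.1 q.2.1 q.2.2) ∂μc ≤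
      b * ∫ q in R i, gnoDeficit z (fun _ => 1) q.1 q.2.1 q.2.2 * Real.exp (-b * gnoDeficit z (fun _ => 1) q.1 q.2.1 q.2.2) ∂μc)
    (hcore : κ * ∫ q in N, Real.exp (-b * gnoDeficit z (fun _ => 1) q.1 q.2.1 q.2.2) ∂μc ≤
      sur * ∑ i ∈ s, ∫ q in R i, Real.exp (-b * gnoDeficit z (fun _ => 1) q.1 q.2.1 q.2.2) ∂μc)
    (hfar : ∀ q : ℍ × GnoSign L × GnoCoord L, q ∉ N → q ∉ (⋃ i ∈ s, R i) → κ ≤ b * gnoDeficit z (fun _ => 1) q.1 q.2.1 q.2.2) :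
    κ * ∫ p, Real.exp (-(b * swapRingDeficit L z p)) ∂(ringMeasure L) ≤
      b * ∫ p, swapRingDeficit L z p * Real.exp (-(b * swapRingDeficit L z p)) ∂(ringMeasure L) := by
  haveI := isFiniteMeasure_chartMeasure μc hμc
  obtain ⟨B, hB⟩ := gnoDeficit_triple_bound (L := L) z
  exact sector_stiffness_of_chart_stiffness z hb.le μc hμc
    (stiffness_of_regions_and_core μc (measurable_gnoDeficit_triple z _) hB (fun q => gnoDeficit_nonneg z _ q.1 q.2.1 q.2.2)
      s R hR hdisj hN hNdisj hb hloc hcore hfar)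

end Summit.QuantumFields.YangMills.Theorems.SwapVirialDeficit.BlowUpRing

end
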